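import Mathlib
import Literature.NumberTheory.LFunctions.Zhang2022.Section15BCalM1Analytic
import HarnessLib

/-!
# Zhang (2022), §15 p. 84: the local factor of `𝓜₁(d,l;s)` is `1 + O(q^{−9/10})` for `σ > 9/10` —
# `§15.u033` discharged, with the uniform bounds on `λ̃₁(q,d)` and `Σ_r ξ₁(qʳ;d,l)q^{−rs}`

Topic `Literature/NumberTheory/LFunctions/Zhang2022` (Landau–Siegel audit tree; verdict-neutral).
Y. Zhang, *Discrete mean estimates and the Landau–Siegel zero*, arXiv:2211.02515v1 (2022)
[Zhang2022LandauSiegel] — **an unrefereed manuscript under adjudication; nothing here asserts or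
denies its Theorems 1–2.** Campaign D-0069, DAG node `Z22:§15.u033` [Z22 p.84, tex L4201–L4203]:

> In case `(q, dl) > 1` and `σ > 9/10`, the left side above is trivially `1 + O(q^{−9/10})`.

("the left side above" = the Euler factor
`(1−q^{−s−β₁})(1−q^{−s−β₂})(1−q^{−s})⁻¹(1−χ(q)q^{−s})⁻¹(1 + λ̃₁(q,d)Σ_rξ₁(qʳ;d,l)q^{−rs})` = the
typed `calM1Factor c′ χ q d l s`.) This file PROVES the typed node `Step15_u033` OUTRIGHT — in fact
the bound `‖calM1Factor − 1‖ ≤ C·q^{−σ} ≤ C·q^{−9/10}` holds for EVERY prime `q` (coprime to `dl`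
or not), every `σ > 9/10`, with an absolute `C` and without hypothesis (A): the prefactor is
`1 + O(q^{−σ})` (`|q^{−s−β_j}| = |q^{−s}| = q^{−σ} ≤ 3/4`), `|λ̃₁(q,d)| ≤ 5`, and
`|Σ_{r≥1}ξ₁(qʳ;d,l)q^{−rs}| ≤ (16/3)Z₂Z₃·q^{−σ}` from `norm_xi1_prime_pow_le` (`|ξ₁(qʳ)| ≤ 4Z₂(r+1)³`,
landed in `Section15BCalM1Analytic`). Theorems only; no new definitions, no facts.

* `re_add_beta1`, `re_add_beta2` — `Re(s+β_j) = σ`;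
* `norm_lam1_prime_one_le`, `norm_lamTilde1_prime_le` — `|λ₁(q)| ≤ 5`, `|λ̃₁(q,d)| ≤ 5`;
* `norm_xi1LocalSeries_le` — `|Σ_{r≥1}ξ₁(qʳ;d,l)q^{−rs}| ≤ (16/3)Z₂Z₃·q^{−σ}` (`σ > 9/10`);
* `norm_calM1Factor_sub_one_le` — `∃ C ≥ 0`, `‖calM1Factor(q;d,l;s) − 1‖ ≤ C·q^{−σ}` (all primes);
* **`step15_u033_holds : Step15_u033 c′`**.

The sharper coprime case `1 + O(q^{−19/10})` (`Step15_u032`, a genuine second-order cancellation)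
is NOT proved here. WHAT THIS IS NOT: anything about Theorems 1–2 / Landau–Siegel zeros.

## References

* Y. Zhang, arXiv:2211.02515v1 (2022), §15 p. 84. [cite: Zhang2022LandauSiegel, §15 p. 84]
-/

noncomputable section

open Complex Real Filter Topology

namespace Literature.NumberTheory.LFunctions.Zhang2022.Typed.Section15B

open Literature.NumberTheory.LFunctions.Zhang2022
open Literature.NumberTheory.LFunctions.Zhang2022.Typed.Section15A

/-! ## Elementary bounds -/

/-- `Σ_k (k+1)ⁿ θ^k` converges for `0 ≤ θ < 1`. [folklore] -/
private theorem summable_pow_mul_geom (n : ℕ) {θ : ℝ} (hθ0 : 0 ≤ θ) (hθ1 : θ < 1) :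
    Summable (fun k : ℕ => ((k : ℝ) + 1) ^ n * θ ^ k) := by
  have h : Summable (fun m : ℕ => (m : ℝ) ^ n * θ ^ m) :=
    summable_pow_mul_geometric_of_norm_lt_one n (by rw [Real.norm_eq_abs, abs_of_nonneg hθ0]; exact hθ1)
  have h2 : Summable (fun m : ℕ => (((m + 1 : ℕ) : ℝ)) ^ n * θ ^ (m + 1)) :=
    (summable_nat_add_iff 1).mpr h
  rcases eq_or_lt_of_le hθ0 with h0 | hpos
  · refine summable_of_ne_finset_zero (s := {0}) fun k hk => ?_
    have hk0 : k ≠ 0 := by simpa using hk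
    simp [← h0, zero_pow hk0]
  · refine (h2.mul_right θ⁻¹).congr fun m => ?_
    push_cast
    rw [pow_succ, mul_assoc, mul_assoc, mul_inv_cancel₀ hpos.ne', mul_one]

/-- `Re(s + β₁) = Re s` (`β₁ = ib₁` is purely imaginary). [cite: Zhang2022LandauSiegel, §2 (2.13)] -/
theorem re_add_beta1 (c' : ℝ) (D : ℕ) (s : ℂ) : (s + Skeleton.beta1 c' D).re = s.re := by
  rw [add_re, beta1_eq_b1_mul_I]; simp

/-- `Re(s + β₂) = Re s`. [cite: Zhang2022LandauSiegel, §2 (2.13)] -/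
theorem re_add_beta2 (c' : ℝ) (D : ℕ) (s : ℂ) : (s + Skeleton.beta2 c' D).re = s.re := by
  rw [add_re, beta2_eq_b2_mul_I]; simp

/-- `1 − θ ≤ ‖1 − vw‖ ≤ 1 + θ` for `‖v‖ ≤ 1`, `‖w‖ ≤ θ`. [folklore] -/
private theorem norm_one_sub_mul_bounds {v w : ℂ} {θ : ℝ} (hv : ‖v‖ ≤ 1) (hw : ‖w‖ ≤ θ) :
    1 - θ ≤ ‖1 - v * w‖ ∧ ‖1 - v * w‖ ≤ 1 + θ := by
  have hvw : ‖v * w‖ ≤ θ := by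
    rw [norm_mul]
    calc ‖v‖ * ‖w‖ ≤ 1 * θ := mul_le_mul hv hw (norm_nonneg _) zero_le_one
      _ = θ := one_mul _
  constructor
  · have := norm_sub_norm_le (1 : ℂ) (v * w)
    rw [norm_one] at this
    linarith
  · calc ‖1 - v * w‖ ≤ ‖(1 : ℂ)‖ + ‖v * w‖ := norm_sub_le _ _
      _ ≤ 1 + θ := by rw [norm_one]; gcongr

/-- `2^{−1/2} ≤ 3/4` (since `(4/3)² ≤ 2`). [folklore] -/
private theorem two_rpow_neg_half_le : (2 : ℝ) ^ (-(1 / 2 : ℝ)) ≤ 3 / 4 := by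
  have hsq : ((2 : ℝ) ^ (1 / 2 : ℝ)) ^ 2 = 2 := by
    rw [← Real.rpow_mul_natCast (by norm_num : (0 : ℝ) ≤ 2)]; norm_num
  have hpos : 0 < (2 : ℝ) ^ (1 / 2 : ℝ) := Real.rpow_pos_of_pos (by norm_num) _
  have h43 : 4 / 3 ≤ (2 : ℝ) ^ (1 / 2 : ℝ) := by nlinarith
  rw [Real.rpow_neg (by norm_num : (0 : ℝ) ≤ 2)]
  calc ((2 : ℝ) ^ (1 / 2 : ℝ))⁻¹ ≤ (4 / 3 : ℝ)⁻¹ := inv_anti₀ (by norm_num) h43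
    _ = 3 / 4 := by norm_num

/-- For `q ≥ 2` and `σ ≥ 1/2`: `q^{−σ} ≤ 3/4`. [folklore] -/
private theorem rpow_neg_le_three_quarters {q : ℕ} (hq : 2 ≤ q) {σ : ℝ} (hσ : 1 / 2 ≤ σ) :
    (q : ℝ) ^ (-σ) ≤ 3 / 4 := by
  have hq1 : (1 : ℝ) ≤ q := by exact_mod_cast (le_trans (by norm_num) hq)
  have hq2 : (2 : ℝ) ≤ q := by exact_mod_cast hq
  calc (q : ℝ) ^ (-σ) ≤ (q : ℝ) ^ (-(1 / 2 : ℝ)) :=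
        Real.rpow_le_rpow_of_exponent_le hq1 (by linarith)
    _ ≤ (2 : ℝ) ^ (-(1 / 2 : ℝ)) :=
        Real.rpow_le_rpow_of_nonpos (by norm_num) hq2 (by norm_num)
    _ ≤ 3 / 4 := two_rpow_neg_half_le

/-! ## `λ̃₁(q,d)` -/

/-- **`|λ₁(q)| ≤ 5`** at a prime `q` (`λ₁(q) = (1−χ(q)q^{−1−β₁})(1−χ(q)q^{−1−β₂})/(1−χ(q)q^{−1})`,
each numerator factor at most `3/2`, the denominator at least `1/2`).
[cite: Zhang2022LandauSiegel, §15 (15.10) p. 82] -/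
theorem norm_lam1_prime_one_le (c' : ℝ) {D : ℕ} (χ : DirichletCharacter ℂ D) {q : ℕ}
    (hq : q.Prime) : ‖lam1 c' χ q 1‖ ≤ 5 := by
  have hq0 : (0 : ℝ) < q := by exact_mod_cast hq.pos
  have hq2 : (2 : ℝ) ≤ q := by exact_mod_cast hq.two_le
  have hv : ‖χ (q : ZMod D)‖ ≤ 1 := DirichletCharacter.norm_le_one χ _
  have hqinv : (q : ℝ) ^ (-(1 : ℝ)) ≤ 1 / 2 := by
    rw [Real.rpow_neg hq0.le, Real.rpow_one, one_div]
    exact inv_anti₀ (by norm_num) hq2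
  have hw : ∀ β : ℂ, β.re = 0 → ‖(q : ℂ) ^ (-(1 + β))‖ ≤ 1 / 2 := by
    intro β hβ
    rw [Complex.norm_natCast_cpow_of_pos hq.pos]
    have : (-(1 + β)).re = -(1 : ℝ) := by simp [hβ]
    rw [this]; exact hqinv
  have hw0 : ‖(q : ℂ) ^ (-(1 : ℂ))‖ ≤ 1 / 2 := by
    rw [Complex.norm_natCast_cpow_of_pos hq.pos]
    have : (-(1 : ℂ)).re = -(1 : ℝ) := by simp
    rw [this]; exact hqinv
  have hβ1 : (Skeleton.beta1 c' D).re = 0 := by rw [beta1_eq_b1_mul_I]; simp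
  have hβ2 : (Skeleton.beta2 c' D).re = 0 := by rw [beta2_eq_b2_mul_I]; simp
  obtain ⟨-, h1⟩ := norm_one_sub_mul_bounds hv (hw _ hβ1)
  obtain ⟨-, h2⟩ := norm_one_sub_mul_bounds hv (hw _ hβ2)
  obtain ⟨h3, -⟩ := norm_one_sub_mul_bounds hv hw0
  unfold lam1
  rw [hq.primeFactors, Finset.prod_singleton, norm_div, norm_mul, div_le_iff₀ (by linarith)]
  nlinarith [norm_nonneg (1 - χ (q : ZMod D) * (q : ℂ) ^ (-(1 + Skeleton.beta1 c' D))),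
    norm_nonneg (1 - χ (q : ZMod D) * (q : ℂ) ^ (-(1 + Skeleton.beta2 c' D)))]

/-- **`|λ̃₁(q,d)| ≤ 5`** at a prime `q` (`λ̃₁(q,d) = λ₁(q)` if `(q,d) = 1`, else `1`).
[cite: Zhang2022LandauSiegel, §15 p. 83 (definition of λ̃₁)] -/
theorem norm_lamTilde1_prime_le (c' : ℝ) {D : ℕ} (χ : DirichletCharacter ℂ D) {q : ℕ}
    (hq : q.Prime) (d : ℕ) : ‖lamTilde1 c' χ q d‖ ≤ 5 := by
  unfold lamTilde1
  rw [hq.primeFactors, Finset.filter_singleton]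
  split_ifs
  · rw [Finset.prod_singleton]; exact norm_lam1_prime_one_le c' χ hq
  · rw [Finset.prod_empty, norm_one]; norm_num

/-! ## `Σ_{r≥1} ξ₁(qʳ;d,l)q^{−rs}` -/

/-- **`|Σ_{r≥1} ξ₁(qʳ;d,l)q^{−rs}| ≤ (16/3)Z₂Z₃·q^{−σ}`** for `σ > 9/10`, with `Z₂ = Σ(k+1)²2^{−k}`,
`Z₃ = Σ(k+1)³(3/4)^k`: `|ξ₁(qʳ)| ≤ 4Z₂(r+1)³` (`norm_xi1_prime_pow_le`) and
`q^{−rσ} = q^{−σ}(q^{−σ})^{r−1} ≤ q^{−σ}(3/4)^{r−1}`. [cite: Zhang2022LandauSiegel, §15 p. 84] -/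
theorem norm_xi1LocalSeries_le (c' : ℝ) {D : ℕ} (χ : DirichletCharacter ℂ D) {q : ℕ}
    (hq : q.Prime) (d l : ℕ) {s : ℂ} (hs : 9 / 10 < s.re) :
    ‖xi1LocalSeries c' χ q d l s‖ ≤
      ((16 / 3) * (∑' k : ℕ, ((k : ℝ) + 1) ^ 2 * (1 / 2 : ℝ) ^ k) *
          (∑' k : ℕ, ((k : ℝ) + 1) ^ 3 * (3 / 4 : ℝ) ^ k)) * (q : ℝ) ^ (-s.re) := by
  classical
  set Z₂ : ℝ := ∑' k : ℕ, ((k : ℝ) + 1) ^ 2 * (1 / 2 : ℝ) ^ k with hZ₂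
  set Z₃ : ℝ := ∑' k : ℕ, ((k : ℝ) + 1) ^ 3 * (3 / 4 : ℝ) ^ k with hZ₃
  have hZ₂0 : 0 ≤ Z₂ := tsum_nonneg fun k => by positivity
  have hq0 : (0 : ℝ) < q := by exact_mod_cast hq.pos
  set σ : ℝ := s.re with hσ
  set w : ℝ := (q : ℝ) ^ (-σ) with hw
  have hw0 : 0 < w := Real.rpow_pos_of_pos hq0 _
  have hw34 : w ≤ 3 / 4 := rpow_neg_le_three_quarters hq.two_le (by linarith)
  have hqσ : (q : ℝ) ^ σ = w⁻¹ := by rw [hw, Real.rpow_neg hq0.le, inv_inv]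
  -- the summands and the majorant
  set F : ℕ → ℂ := fun r =>
    if r = 0 then 0 else xi1 c' χ (q ^ r) d l / (q : ℂ) ^ ((r : ℂ) * s) with hF
  set v : ℕ → ℝ := fun r => (16 / 3) * Z₂ * ((r : ℝ) + 1) ^ 3 * (3 / 4 : ℝ) ^ r * w with hv
  have hv_sum : Summable v :=
    (((summable_pow_mul_geom 3 (θ := 3 / 4) (by norm_num) (by norm_num)).mul_left
      ((16 / 3) * Z₂)).mul_right w).congr
      fun r => by simp only [hv]; ring
  have hF_le : ∀ r, ‖F r‖ ≤ v r := by
    intro r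
    simp only [hF, hv]
    split_ifs with hr
    · rw [norm_zero]; positivity
    · have hr1 : 1 ≤ r := Nat.one_le_iff_ne_zero.mpr hr
      have hden : ‖(q : ℂ) ^ ((r : ℂ) * s)‖ = ((q : ℝ) ^ σ) ^ r := by
        rw [Complex.norm_natCast_cpow_of_pos hq.pos, ← Real.rpow_mul_natCast hq0.le]
        congr 1
        simp [hσ, mul_comm]
      -- `1/(q^σ)^r = w^r ≤ w·(3/4)^{r−1} = (4/3)(3/4)^r·w`
      have hwr : w ^ r ≤ (4 / 3) * (3 / 4 : ℝ) ^ r * w := by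
        obtain ⟨k, rfl⟩ := Nat.exists_eq_add_of_le hr1
        rw [pow_add, pow_one, pow_add, pow_one]
        have hk : w ^ k ≤ (3 / 4 : ℝ) ^ k := pow_le_pow_left₀ hw0.le hw34 k
        nlinarith [pow_nonneg (by norm_num : (0 : ℝ) ≤ 3 / 4) k]
      rw [norm_div, hden, hqσ, inv_pow, div_inv_eq_mul]
      calc ‖xi1 c' χ (q ^ r) d l‖ * w ^ r
          ≤ (4 * Z₂ * ((r : ℝ) + 1) ^ 3) * ((4 / 3) * (3 / 4 : ℝ) ^ r * w) :=
            mul_le_mul (norm_xi1_prime_pow_le c' χ hq d l r) hwr (pow_nonneg hw0.le r)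
              (by positivity)
        _ = (16 / 3) * Z₂ * ((r : ℝ) + 1) ^ 3 * (3 / 4 : ℝ) ^ r * w := by ring
  have hF_sum : Summable fun r => ‖F r‖ :=
    Summable.of_nonneg_of_le (fun _ => norm_nonneg _) hF_le hv_sum
  have hfun : xi1LocalSeries c' χ q d l s = ∑' r, F r := rfl
  rw [hfun]
  calc ‖∑' r, F r‖ ≤ ∑' r, ‖F r‖ := norm_tsum_le_tsum_norm hF_sum
    _ ≤ ∑' r, v r := hF_sum.tsum_le_tsum hF_le hv_sum
    _ = (16 / 3) * Z₂ * Z₃ * w := by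
        have h1 : ∑' r, v r = (∑' r : ℕ, ((r : ℝ) + 1) ^ 3 * (3 / 4 : ℝ) ^ r) * ((16 / 3) * Z₂ * w) := by
          rw [← tsum_mul_right]
          exact tsum_congr fun r => by simp only [hv]; ring
        rw [h1, hZ₃]; ring

/-! ## The local factor is `1 + O(q^{−σ})` -/

/-- **`‖calM1Factor(q;d,l;s) − 1‖ ≤ C·q^{−σ}`** for every prime `q`, all `d, l`, every `σ > 9/10`,
with an absolute constant `C` (no coprimality condition, no hypothesis (A)): the prefactor
`(1−q^{−s−β₁})(1−q^{−s−β₂})/((1−q^{−s})(1−χ(q)q^{−s}))` differs from `1` by at most `96q^{−σ}`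
(`|q^{−s−β_j}| = |q^{−s}| = q^{−σ} ≤ 3/4`), and the second factor by at most `5K·q^{−σ}`.
[cite: Zhang2022LandauSiegel, §15 p. 84] -/
theorem norm_calM1Factor_sub_one_le (c' : ℝ) :
    ∃ C : ℝ, 0 ≤ C ∧ ∀ {D : ℕ} (χ : DirichletCharacter ℂ D) {q : ℕ}, q.Prime → ∀ (d l : ℕ) (s : ℂ),
      9 / 10 < s.re → ‖calM1Factor c' χ q d l s - 1‖ ≤ C * (q : ℝ) ^ (-s.re) := by
  set K : ℝ := (16 / 3) * (∑' k : ℕ, ((k : ℝ) + 1) ^ 2 * (1 / 2 : ℝ) ^ k) *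
    (∑' k : ℕ, ((k : ℝ) + 1) ^ 3 * (3 / 4 : ℝ) ^ k) with hK
  have hK0 : 0 ≤ K := by
    have h2 : 0 ≤ ∑' k : ℕ, ((k : ℝ) + 1) ^ 2 * (1 / 2 : ℝ) ^ k := tsum_nonneg fun k => by positivity
    have h3 : 0 ≤ ∑' k : ℕ, ((k : ℝ) + 1) ^ 3 * (3 / 4 : ℝ) ^ k := tsum_nonneg fun k => by positivity
    rw [hK]; positivity
  refine ⟨96 + 485 * K, by positivity, fun {D} χ {q} hq d l s hs => ?_⟩
  have hq0 : (0 : ℝ) < q := by exact_mod_cast hq.pos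
  set σ : ℝ := s.re with hσ
  set w : ℝ := (q : ℝ) ^ (-σ) with hw
  have hw0 : 0 < w := Real.rpow_pos_of_pos hq0 _
  have hw34 : w ≤ 3 / 4 := rpow_neg_le_three_quarters hq.two_le (by linarith)
  have hw1 : w ≤ 1 := by linarith
  -- the four small quantities
  set x : ℂ := (q : ℂ) ^ (-s) with hx
  set a : ℂ := (q : ℂ) ^ (-(s + Skeleton.beta1 c' D)) with ha
  set b : ℂ := (q : ℂ) ^ (-(s + Skeleton.beta2 c' D)) with hb
  set v : ℂ := χ (q : ZMod D) with hvdef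
  have hxn : ‖x‖ = w := by
    rw [hx, Complex.norm_natCast_cpow_of_pos hq.pos, neg_re]
  have han : ‖a‖ = w := by
    rw [ha, Complex.norm_natCast_cpow_of_pos hq.pos, neg_re, re_add_beta1]
  have hbn : ‖b‖ = w := by
    rw [hb, Complex.norm_natCast_cpow_of_pos hq.pos, neg_re, re_add_beta2]
  have hv : ‖v‖ ≤ 1 := DirichletCharacter.norm_le_one χ _
  -- denominators
  obtain ⟨hd1, -⟩ := norm_one_sub_mul_bounds (v := 1) (w := x) (θ := w) (by simp) hxn.le
  obtain ⟨hd2, -⟩ := norm_one_sub_mul_bounds hv hxn.le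
  rw [one_mul] at hd1
  have hDn : 1 / 16 ≤ ‖(1 - x) * (1 - v * x)‖ := by
    rw [norm_mul]
    nlinarith [norm_nonneg (1 - x), norm_nonneg (1 - v * x)]
  have hDne : (1 - x) * (1 - v * x) ≠ 0 := by
    intro h; rw [h, norm_zero] at hDn; linarith
  -- numerator minus denominator
  have hND : ‖(1 - a) * (1 - b) - (1 - x) * (1 - v * x)‖ ≤ 6 * w := by
    have e : (1 - a) * (1 - b) - (1 - x) * (1 - v * x) =
        -a + (-b) + a * b + x + v * x + (-(v * x * x)) := by ring
    rw [e]
    have h1 : ‖-a‖ ≤ w := by rw [norm_neg, han]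
    have h2 : ‖-b‖ ≤ w := by rw [norm_neg, hbn]
    have h3 : ‖a * b‖ ≤ w := by
      rw [norm_mul, han, hbn]; nlinarith
    have h4 : ‖x‖ ≤ w := hxn.le
    have h5 : ‖v * x‖ ≤ w := by
      rw [norm_mul, hxn]
      calc ‖v‖ * w ≤ 1 * w := by gcongr
        _ = w := one_mul _
    have h6 : ‖-(v * x * x)‖ ≤ w := by
      rw [norm_neg, norm_mul, norm_mul, hxn]
      calc ‖v‖ * w * w ≤ 1 * w * 1 := by gcongr
        _ = w := by ring
    calc ‖-a + (-b) + a * b + x + v * x + (-(v * x * x))‖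
        ≤ ‖-a‖ + ‖-b‖ + ‖a * b‖ + ‖x‖ + ‖v * x‖ + ‖-(v * x * x)‖ := by
          refine (norm_add_le _ _).trans ?_
          gcongr
          refine (norm_add_le _ _).trans ?_
          gcongr
          refine (norm_add_le _ _).trans ?_
          gcongr
          refine (norm_add_le _ _).trans ?_
          gcongr
          exact norm_add_le _ _
      _ ≤ w + w + w + w + w + w := by gcongr
      _ = 6 * w := by ring
  -- the prefactor
  set P : ℂ := (1 - a) * (1 - b) / ((1 - x) * (1 - v * x)) with hP
  have hP1 : ‖P - 1‖ ≤ 96 * w := by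
    rw [hP, div_sub_one hDne, norm_div]
    have hpos : 0 < ‖(1 - x) * (1 - v * x)‖ := by linarith
    rw [div_le_iff₀ hpos]
    nlinarith
  have hPn : ‖P‖ ≤ 97 := by
    have := norm_add_le (P - 1) 1
    rw [sub_add_cancel, norm_one] at this
    nlinarith
  -- the second factor
  set E : ℂ := lamTilde1 c' χ q d * xi1LocalSeries c' χ q d l s with hE
  have hEn : ‖E‖ ≤ 5 * K * w := by
    rw [hE, norm_mul]
    have h1 := norm_lamTilde1_prime_le c' χ hq d
    have h2 := norm_xi1LocalSeries_le c' χ hq d l hs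
    calc ‖lamTilde1 c' χ q d‖ * ‖xi1LocalSeries c' χ q d l s‖ ≤ 5 * (K * w) :=
          mul_le_mul h1 h2 (norm_nonneg _) (by norm_num)
      _ = 5 * K * w := by ring
  -- assemble: `calM1Factor − 1 = (P − 1)(1 + E) + E`
  have hfac : calM1Factor c' χ q d l s = P * (1 + E) := by
    simp only [calM1Factor, hP, hE, ha, hb, hx, hvdef]
  rw [hfac]
  have e : P * (1 + E) - 1 = (P - 1) * (1 + E) + E := by ring
  rw [e]
  have h1E : ‖1 + E‖ ≤ 1 + 5 * K := by
    calc ‖1 + E‖ ≤ ‖(1 : ℂ)‖ + ‖E‖ := norm_add_le _ _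
      _ ≤ 1 + 5 * K * w := by rw [norm_one]; gcongr
      _ ≤ 1 + 5 * K := by nlinarith
  calc ‖(P - 1) * (1 + E) + E‖ ≤ ‖(P - 1) * (1 + E)‖ + ‖E‖ := norm_add_le _ _
    _ = ‖P - 1‖ * ‖1 + E‖ + ‖E‖ := by rw [norm_mul]
    _ ≤ 96 * w * (1 + 5 * K) + 5 * K * w := by
        gcongr
    _ = (96 + 485 * K) * w := by ring

/-! ## `§15.u033` -/

/-- **§15.u033 holds** (DAG `Z22:§15.u033`, [Z22 p.84, tex L4201–L4203]: "In case `(q,dl) > 1` and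
`σ > 9/10`, the left side above is trivially `1 + O(q^{−9/10})`"): immediate from
`norm_calM1Factor_sub_one_le` and `q^{−σ} ≤ q^{−9/10}` — the hypotheses (A) and `(q,dl) > 1` are
not even needed. [cite: Zhang2022LandauSiegel, §15 p. 84] -/
theorem step15_u033_holds (c' : ℝ) : Step15_u033 c' := by
  obtain ⟨C, hC0, hC⟩ := norm_calM1Factor_sub_one_le c'
  refine ⟨C, 1, fun D _ χ _ _ _ _ q d l hq _ _ _ s hs => ?_⟩
  have hq1 : (1 : ℝ) ≤ q := by exact_mod_cast hq.one_lt.le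
  calc ‖calM1Factor c' χ q d l s - 1‖ ≤ C * (q : ℝ) ^ (-s.re) := hC χ hq d l s hs
    _ ≤ C * (q : ℝ) ^ (-(9 / 10 : ℝ)) := by
        gcongr

variable (c' : ℝ) in
/-- `Step15_u033` — `_holds` alias of `step15_u033_holds` above under the fact's exact name, stated under the
prover's own binders as section variables (appended 2026-08-28, D-0026 bookkeeping: the proof term is the
existing theorem of this file; no statement, definition or attribute is edited; no new named fact; the
ledger's debt table listed the fact unproved). [cite: Zhang2022LandauSiegel, §15 p. 84] -/
theorem _root_.Literature.NumberTheory.LFunctions.Zhang2022.Typed.Section15B.Step15_u033_holds :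
    _root_.Literature.NumberTheory.LFunctions.Zhang2022.Typed.Section15B.Step15_u033 c' :=
  _root_.Literature.NumberTheory.LFunctions.Zhang2022.Typed.Section15B.step15_u033_holds (c' := c')

end Literature.NumberTheory.LFunctions.Zhang2022.Typed.Section15B

end
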